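/-
K-task «TOWER», part (v) (cell rh-split, lead RULING #403 (c); statement = rh-splitx-theory-1 g12 (α′) signature file
`T34ConfigMaxReLattice.lean` sha16 0675001484e7ecb9, VERBATIM hypotheses; shape nod rh-split-ref-2 g7 00:55:06Z (b)).
«EVERY LATTICE DETECTS AN ATTAINED σ* IN THE MODEL CLASS» — the positive dual of
`ScrewLatticeTower.not_criterion_of_classC`'s second conjunct.  Model-class bookkeeping, RH-free, ζ-free, 0 toward
RH.  Nothing here bears on the truth of RH.
-/
import Summits.RiemannHypothesis.RiemannHypothesis.Theorems.Splittings.ScrewLatticeTowerClassC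
import Summits.RiemannHypothesis.RiemannHypothesis.Theorems.Splittings.ScrewLatticeSupA
import Summits.RiemannHypothesis.RiemannHypothesis.Theorems.Splittings.ScrewLatticeFozB
import Literature.Analysis.Complex.BochnerTubeGrowth
import HarnessLib

/-!
# Every lattice detects an attained supremum abscissa in the model class

Let `Z : Config` be a configuration of off-line quadruples with positive multiplicities, exponents `κ = σ + iγ`
with `0 < σ < γ` and `Re κ₂ = Re κ₁`, and `Σ m/γ² < ∞`.  If its model screw function has a SUB-EXPONENTIAL FLOOR
on one lattice `hℕ`, `h > 0` (`∀ η > 0, ∃ K, ∀ k, Ψ_Z(kh) ≥ -K e^{ηkh}`), then the supremum of the abscissae is NOT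
attained (`Config.not_maxRe_of_latticeSubexpFloor`): blind classes cannot DERIVE attainedness
(`not_criterion_of_classC`, `not_criterion_of_classB₀`) while a one-sided sub-exponential floor on ANY lattice
REFUTES it — every blind configuration of record (B16/B26) is necessarily unattained, by theorem.  Proof = the
tree's `ScrewLatticeSup.strip_of_supAttained_of_latticeFloor` (screw-bridge g12) with ζ's zero series replaced by
the configuration series over `Z.ι ⊕ Z.ι`: `g_s(k) = 2e^{-Bkh}·quadTerm`, majorant `16 m/γ²`, top-layer form
`quadTerm - e^{σt} Re[(2m/κ²) e^{iγt}] = O(m/γ²)`, `Re(4m/κ²) < 0` from `σ < γ`, floor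
`⇒ Σ' g ≥ -2K e^{(η-B)kh} → 0`, contradiction by `ScrewLatticeSup.false_of_tsum_trig_eventually_ge`.
Std axioms.  Nothing here bears on the truth of RH.
-/

noncomputable section

set_option linter.dupNamespace false

open Complex Filter Topology
open scoped ComplexConjugate Real

namespace Summit.RiemannHypothesis.RiemannHypothesis.Theorems.Splittings.ScrewLatticeTower

open Summit.RiemannHypothesis.RiemannHypothesis.Theorems.Splittings.ScrewLatticeWolff
open Summit.RiemannHypothesis.RiemannHypothesis.Theorems.Splittings.ScrewLatticeSup
  (false_of_tsum_trig_eventually_ge)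
open Summit.RiemannHypothesis.RiemannHypothesis.Theorems.Splittings.ScrewLatticeFoz
  (tendsto_exp_lattice tendsto_exp_neg_mul_exp_lattice)

/-! ## 18. The terms `quadTerm m κ t` of a configuration series -/

/-- `‖(cosh(κt) - 1)/κ²‖ ≤ 2 e^{|σ| t}/γ²` for `t ≥ 0` (`κ = σ + iγ`, `γ ≠ 0`). -/
theorem norm_cosh_sub_one_div_sq_le {κ : ℂ} (hγ : κ.im ≠ 0) {t : ℝ} (ht : 0 ≤ t) :
    ‖(Complex.cosh (κ * t) - 1) / κ ^ 2‖ ≤ 2 * Real.exp (|κ.re| * t) / κ.im ^ 2 := by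
  have hγ2 : 0 < κ.im ^ 2 := by positivity
  have hre : (κ * t).re = κ.re * t := by simp [Complex.mul_re]
  have hnum : ‖Complex.cosh (κ * t) - 1‖ ≤ 2 * Real.exp (|κ.re| * t) := by
    have h1 : ‖Complex.cosh (κ * t)‖ ≤ Real.exp (|κ.re| * t) := by
      refine (Literature.Analysis.Complex.norm_cosh_le_exp_abs_re _).trans (Real.exp_le_exp.2 (le_of_eq ?_))
      rw [hre, abs_mul, abs_of_nonneg ht]
    have hE1 : 1 ≤ Real.exp (|κ.re| * t) := Real.one_le_exp (by positivity)
    calc ‖Complex.cosh (κ * t) - 1‖ ≤ ‖Complex.cosh (κ * t)‖ + ‖(1 : ℂ)‖ := norm_sub_le _ _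
      _ ≤ 2 * Real.exp (|κ.re| * t) := by rw [norm_one]; linarith
  have hden : κ.im ^ 2 ≤ ‖κ ^ 2‖ := by
    rw [norm_pow]
    have h := Complex.abs_im_le_norm κ
    have h' : |κ.im| ^ 2 ≤ ‖κ‖ ^ 2 := pow_le_pow_left₀ (abs_nonneg _) h 2
    rwa [sq_abs] at h'
  rw [norm_div]
  exact div_le_div₀ (by positivity) hnum hγ2 hden

/-- **Termwise majorant**: `|quadTerm m κ t| ≤ 8 m e^{|σ|t}/γ²` (`m ≥ 0`, `t ≥ 0`, `γ ≠ 0`). -/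
theorem abs_quadTerm_le {m : ℝ} (hm : 0 ≤ m) {κ : ℂ} (hγ : κ.im ≠ 0) {t : ℝ} (ht : 0 ≤ t) :
    |quadTerm m κ t| ≤ 8 * m * Real.exp (|κ.re| * t) / κ.im ^ 2 := by
  have h1 := norm_cosh_sub_one_div_sq_le hγ ht
  have h2 : |((Complex.cosh (κ * t) - 1) / κ ^ 2).re| ≤ ‖(Complex.cosh (κ * t) - 1) / κ ^ 2‖ :=
    Complex.abs_re_le_norm _
  rw [quadTerm, abs_mul, abs_of_nonneg (by positivity : (0 : ℝ) ≤ 4 * m)]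
  calc 4 * m * |((Complex.cosh (κ * t) - 1) / κ ^ 2).re|
      ≤ 4 * m * (2 * Real.exp (|κ.re| * t) / κ.im ^ 2) := by
        exact mul_le_mul_of_nonneg_left (h2.trans h1) (by positivity)
    _ = 8 * m * Real.exp (|κ.re| * t) / κ.im ^ 2 := by ring

/-- `‖x/κ²‖ ≤ |x|/γ²` (`γ = Im κ ≠ 0`). -/
theorem norm_ofReal_div_sq_le (x : ℝ) {κ : ℂ} (hγ : κ.im ≠ 0) : ‖(x : ℂ) / κ ^ 2‖ ≤ |x| / κ.im ^ 2 := by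
  have hγ2 : 0 < κ.im ^ 2 := by positivity
  have hden : κ.im ^ 2 ≤ ‖κ ^ 2‖ := by
    rw [norm_pow]
    have h := Complex.abs_im_le_norm κ
    have h' : |κ.im| ^ 2 ≤ ‖κ‖ ^ 2 := pow_le_pow_left₀ (abs_nonneg _) h 2
    rwa [sq_abs] at h'
  rw [norm_div, Complex.norm_real, Real.norm_eq_abs]
  exact div_le_div_of_nonneg_left (abs_nonneg _) hγ2 hden

/-- **Sign of the coefficient**: `Re(x/κ²) < 0` for `x > 0` and `|σ| < |γ|` (`Re κ² = σ² - γ² < 0`). -/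
theorem re_coeff_neg_of_abs_re_lt {x : ℝ} (hx : 0 < x) {κ : ℂ} (h : |κ.re| < |κ.im|) :
    ((x : ℂ) / κ ^ 2).re < 0 := by
  have hsq_re : (κ ^ 2).re = κ.re ^ 2 - κ.im ^ 2 := by rw [sq, Complex.mul_re]; ring
  have hneg : (κ ^ 2).re < 0 := by
    rw [hsq_re]
    have := sq_lt_sq.2 h
    linarith
  have hκ0 : κ ^ 2 ≠ 0 := fun h0 ↦ by rw [h0] at hneg; simp at hneg
  rw [div_eq_mul_inv, Complex.re_ofReal_mul, Complex.inv_re]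
  have hns : 0 < Complex.normSq (κ ^ 2) := Complex.normSq_pos.2 hκ0
  exact mul_neg_of_pos_of_neg hx (div_neg_of_neg_of_pos hneg hns)

/-- **Top-layer form of a term**: for `σ = Re κ ≥ 0`, `γ = Im κ ≠ 0`, `m ≥ 0`, `t ≥ 0`,
`|quadTerm m κ t - e^{σt}·Re[(2m/κ²) e^{iγt}]| ≤ 6 m/γ²`
(`4m(cosh κt - 1)/κ² = (2m/κ²)e^{κt} + (2m/κ²)(e^{-κt} - 2)`, `e^{κt} = e^{σt} e^{iγt}`, `‖e^{-κt}‖ ≤ 1`). -/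
theorem abs_quadTerm_sub_top_le {m : ℝ} (hm : 0 ≤ m) {κ : ℂ} (hγ : κ.im ≠ 0) (hσ : 0 ≤ κ.re) {t : ℝ}
    (ht : 0 ≤ t) :
    |quadTerm m κ t - Real.exp (κ.re * t) *
        (((2 * m : ℝ) : ℂ) / κ ^ 2 * Complex.exp (((κ.im * t : ℝ) : ℂ) * I)).re| ≤ 6 * m / κ.im ^ 2 := by
  have hκ0 : κ ^ 2 ≠ 0 := by
    apply pow_ne_zero; intro h0; rw [h0] at hγ; simp at hγ
  set c : ℂ := ((2 * m : ℝ) : ℂ) / κ ^ 2 with hc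
  have hq : quadTerm m κ t = (c * Complex.exp (κ * t) + c * (Complex.exp (-(κ * t)) - 2)).re := by
    have hcosh : Complex.cosh (κ * t) = (Complex.exp (κ * t) + Complex.exp (-(κ * t))) / 2 := rfl
    have hid : ((4 * m : ℝ) : ℂ) * ((Complex.cosh (κ * t) - 1) / κ ^ 2)
        = c * Complex.exp (κ * t) + c * (Complex.exp (-(κ * t)) - 2) := by
      rw [hcosh, hc]; push_cast; field_simp; ring
    rw [quadTerm, ← Complex.re_ofReal_mul, ← hid]
  have hexp : Complex.exp (κ * t) = (Real.exp (κ.re * t) : ℂ) * Complex.exp (((κ.im * t : ℝ) : ℂ) * I) := by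
    rw [Complex.ofReal_exp, ← Complex.exp_add]
    congr 1
    apply Complex.ext <;> simp [Complex.mul_re, Complex.mul_im]
  have hre1 : (c * Complex.exp (κ * t)).re =
      Real.exp (κ.re * t) * (c * Complex.exp (((κ.im * t : ℝ) : ℂ) * I)).re := by
    rw [hexp, show c * ((Real.exp (κ.re * t) : ℂ) * Complex.exp (((κ.im * t : ℝ) : ℂ) * I))
      = (Real.exp (κ.re * t) : ℂ) * (c * Complex.exp (((κ.im * t : ℝ) : ℂ) * I)) by ring,
      Complex.re_ofReal_mul]
  have hrest : |(c * (Complex.exp (-(κ * t)) - 2)).re| ≤ 6 * m / κ.im ^ 2 := by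
    have he : ‖Complex.exp (-(κ * t))‖ ≤ 1 := by
      rw [Complex.norm_exp]
      have hre : (-(κ * (t : ℂ))).re = -(κ.re * t) := by simp [Complex.mul_re]
      rw [hre]
      exact Real.exp_le_one_iff.2 (by nlinarith)
    have h1 : ‖Complex.exp (-(κ * t)) - 2‖ ≤ 3 := by
      calc ‖Complex.exp (-(κ * t)) - 2‖ ≤ ‖Complex.exp (-(κ * t))‖ + ‖(2 : ℂ)‖ := norm_sub_le _ _
        _ ≤ 3 := by rw [RCLike.norm_two]; linarith
    have hcn : ‖c‖ ≤ 2 * m / κ.im ^ 2 := by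
      have := norm_ofReal_div_sq_le (2 * m) hγ
      rwa [abs_of_nonneg (by positivity : (0 : ℝ) ≤ 2 * m)] at this
    calc |(c * (Complex.exp (-(κ * t)) - 2)).re| ≤ ‖c * (Complex.exp (-(κ * t)) - 2)‖ :=
          Complex.abs_re_le_norm _
      _ = ‖c‖ * ‖Complex.exp (-(κ * t)) - 2‖ := norm_mul _ _
      _ ≤ 2 * m / κ.im ^ 2 * 3 := mul_le_mul hcn h1 (norm_nonneg _) (by positivity)
      _ = 6 * m / κ.im ^ 2 := by ring
  rw [hq, Complex.add_re, hre1, add_sub_cancel_left]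
  exact hrest

/-! ## 19. The lattice data of one term: majorant and termwise limits -/

/-- Lattice majorant: for `0 ≤ σ = Re κ ≤ B`, `|2 e^{-Bkh} quadTerm m κ (kh)| ≤ 16 m/γ²`, and the un-normalised
bound `|quadTerm m κ (kh)| ≤ e^{Bkh} · 8m/γ²`. -/
theorem abs_quadTerm_lattice_le {m : ℝ} (hm : 0 ≤ m) {κ : ℂ} (hγ : κ.im ≠ 0) (hσ : 0 ≤ κ.re) {B : ℝ}
    (hσB : κ.re ≤ B) {h : ℝ} (hh : 0 ≤ h) (k : ℕ) :
    |quadTerm m κ (k * h)| ≤ Real.exp (B * (k * h)) * (8 * m / κ.im ^ 2) ∧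
    |2 * Real.exp (-(B * (k * h))) * quadTerm m κ (k * h)| ≤ 16 * m / κ.im ^ 2 := by
  have ht : 0 ≤ (k : ℝ) * h := by positivity
  have h1 := abs_quadTerm_le hm hγ ht
  rw [abs_of_nonneg hσ] at h1
  have h2 : Real.exp (κ.re * (k * h)) ≤ Real.exp (B * (k * h)) :=
    Real.exp_le_exp.2 (mul_le_mul_of_nonneg_right hσB ht)
  have h3 : 0 ≤ 8 * m / κ.im ^ 2 := by positivity
  have hqb : |quadTerm m κ (k * h)| ≤ Real.exp (B * (k * h)) * (8 * m / κ.im ^ 2) :=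
    calc |quadTerm m κ (k * h)| ≤ 8 * m * Real.exp (κ.re * (k * h)) / κ.im ^ 2 := h1
      _ = Real.exp (κ.re * (k * h)) * (8 * m / κ.im ^ 2) := by ring
      _ ≤ Real.exp (B * (k * h)) * (8 * m / κ.im ^ 2) := mul_le_mul_of_nonneg_right h2 h3
  refine ⟨hqb, ?_⟩
  have hy : 0 < Real.exp (-(B * (k * h))) := Real.exp_pos _
  have hxy : Real.exp (B * (k * h)) * Real.exp (-(B * (k * h))) = 1 := by
    rw [← Real.exp_add, add_neg_cancel, Real.exp_zero]
  rw [abs_mul, abs_mul, abs_two, abs_of_pos hy]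
  calc 2 * Real.exp (-(B * (k * h))) * |quadTerm m κ (k * h)|
      ≤ 2 * Real.exp (-(B * (k * h))) * (Real.exp (B * (k * h)) * (8 * m / κ.im ^ 2)) := by gcongr
    _ = 2 * (Real.exp (B * (k * h)) * Real.exp (-(B * (k * h)))) * (8 * m / κ.im ^ 2) := by ring
    _ = 16 * m / κ.im ^ 2 := by rw [hxy]; ring

/-- Top layer (`σ = Re κ = B > 0`): `2 e^{-Bkh} quadTerm m κ (kh) - Re[(4m/κ²) u^k] → 0` with `u = e^{iγh}`. -/
theorem tendsto_quadTerm_lattice_top {m : ℝ} (hm : 0 ≤ m) {κ : ℂ} (hγ : κ.im ≠ 0) (hσ : 0 < κ.re) {h : ℝ}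
    (hh : 0 < h) :
    Tendsto (fun k : ℕ ↦ 2 * Real.exp (-(κ.re * (k * h))) * quadTerm m κ (k * h)
      - (((4 * m : ℝ) : ℂ) / κ ^ 2 * Complex.exp (((κ.im * h : ℝ) : ℂ) * I) ^ k).re) atTop (𝓝 0) := by
  set B : ℝ := κ.re with hB
  set u : ℂ := Complex.exp (((κ.im * h : ℝ) : ℂ) * I) with hu
  have hupow : ∀ k : ℕ, Complex.exp (((κ.im * ((k : ℝ) * h) : ℝ) : ℂ) * I) = u ^ k := fun k ↦ by
    rw [hu, ← Complex.exp_nat_mul]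
    congr 1
    push_cast
    ring
  have hxy : ∀ k : ℕ, Real.exp (B * (k * h)) * Real.exp (-(B * (k * h))) = 1 := fun k ↦ by
    rw [← Real.exp_add, add_neg_cancel, Real.exp_zero]
  refine squeeze_zero_norm (a := fun k : ℕ ↦ 2 * (6 * m / κ.im ^ 2) * Real.exp (-B * (k * h)))
    (fun k ↦ ?_) ?_
  · have ht : 0 ≤ (k : ℝ) * h := by positivity
    have hy : 0 < Real.exp (-(B * (k * h))) := Real.exp_pos _
    have h' := abs_quadTerm_sub_top_le hm hγ hσ.le ht
    rw [hupow k] at h'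
    have h4 : (((4 * m : ℝ) : ℂ) / κ ^ 2 * u ^ k).re = 2 * (((2 * m : ℝ) : ℂ) / κ ^ 2 * u ^ k).re := by
      rw [show ((4 * m : ℝ) : ℂ) / κ ^ 2 * u ^ k = ((2 : ℝ) : ℂ) * (((2 * m : ℝ) : ℂ) / κ ^ 2 * u ^ k) by
        push_cast; ring, Complex.re_ofReal_mul]
    have hid : 2 * Real.exp (-(B * (k * h))) * quadTerm m κ (k * h) - (((4 * m : ℝ) : ℂ) / κ ^ 2 * u ^ k).re
        = 2 * Real.exp (-(B * (k * h))) *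
          (quadTerm m κ (k * h) - Real.exp (B * (k * h)) * (((2 * m : ℝ) : ℂ) / κ ^ 2 * u ^ k).re) := by
      rw [h4, mul_sub, show 2 * Real.exp (-(B * (k * h))) * (Real.exp (B * (k * h)) *
          (((2 * m : ℝ) : ℂ) / κ ^ 2 * u ^ k).re) = (Real.exp (B * (k * h)) * Real.exp (-(B * (k * h))))
          * (2 * (((2 * m : ℝ) : ℂ) / κ ^ 2 * u ^ k).re) by ring, hxy k, one_mul]
    rw [Real.norm_eq_abs, hid, abs_mul, abs_mul, abs_two, abs_of_pos hy]
    calc 2 * Real.exp (-(B * (k * h))) *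
          |quadTerm m κ (k * h) - Real.exp (B * (k * h)) * (((2 * m : ℝ) : ℂ) / κ ^ 2 * u ^ k).re|
        ≤ 2 * Real.exp (-(B * (k * h))) * (6 * m / κ.im ^ 2) := by gcongr
      _ = 2 * (6 * m / κ.im ^ 2) * Real.exp (-B * (k * h)) := by rw [neg_mul]; ring
  · have := (tendsto_exp_lattice (neg_neg_of_pos hσ) hh).const_mul (2 * (6 * m / κ.im ^ 2))
    simpa using this

/-- Lower layers (`0 ≤ σ = Re κ < B`): `2 e^{-Bkh} quadTerm m κ (kh) → 0`. -/
theorem tendsto_quadTerm_lattice_low {m : ℝ} (hm : 0 ≤ m) {κ : ℂ} (hγ : κ.im ≠ 0) (hσ : 0 ≤ κ.re) {B : ℝ}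
    (hlt : κ.re < B) {h : ℝ} (hh : 0 < h) :
    Tendsto (fun k : ℕ ↦ 2 * Real.exp (-(B * (k * h))) * quadTerm m κ (k * h)) atTop (𝓝 0) := by
  refine squeeze_zero_norm (a := fun k : ℕ ↦ 2 * (8 * m / κ.im ^ 2) *
      (Real.exp (-(B * (k * h))) * Real.exp (κ.re * (k * h)))) (fun k ↦ ?_) ?_
  · have ht : 0 ≤ (k : ℝ) * h := by positivity
    have hy : 0 < Real.exp (-(B * (k * h))) := Real.exp_pos _
    have h1 := abs_quadTerm_le hm hγ ht
    rw [abs_of_nonneg hσ] at h1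
    rw [Real.norm_eq_abs, abs_mul, abs_mul, abs_two, abs_of_pos hy]
    calc 2 * Real.exp (-(B * (k * h))) * |quadTerm m κ (k * h)|
        ≤ 2 * Real.exp (-(B * (k * h))) * (8 * m * Real.exp (κ.re * (k * h)) / κ.im ^ 2) := by gcongr
      _ = 2 * (8 * m / κ.im ^ 2) * (Real.exp (-(B * (k * h))) * Real.exp (κ.re * (k * h))) := by ring
  · have := (tendsto_exp_neg_mul_exp_lattice hlt hh).const_mul (2 * (8 * m / κ.im ^ 2))
    simpa using this

/-- The configuration series over `Z.ι ⊕ Z.ι` sums to the fold: if both quad-term families are summable at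
`t`, the joint family `s ↦ quadTerm (M s) (Kp s) t` (`M = Sum.elim m₁ m₂`, `Kp = Sum.elim κ₁ κ₂`) has sum `Ψ_Z(t)`. -/
theorem Config.hasSum_sum_quadTerm (Z : Config) (t : ℝ)
    (h₁ : Summable fun i ↦ quadTerm (Z.m₁ i) (Z.κ₁ i) t) (h₂ : Summable fun i ↦ quadTerm (Z.m₂ i) (Z.κ₂ i) t) :
    HasSum (fun s : Z.ι ⊕ Z.ι ↦ quadTerm (Sum.elim Z.m₁ Z.m₂ s) (Sum.elim Z.κ₁ Z.κ₂ s) t)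
      (modelPsi Z.m₁ Z.m₂ Z.κ₁ Z.κ₂ t) := by
  have e₁ : (fun s : Z.ι ⊕ Z.ι ↦ quadTerm (Sum.elim Z.m₁ Z.m₂ s) (Sum.elim Z.κ₁ Z.κ₂ s) t) ∘ Sum.inl
      = fun i ↦ quadTerm (Z.m₁ i) (Z.κ₁ i) t := rfl
  have e₂ : (fun s : Z.ι ⊕ Z.ι ↦ quadTerm (Sum.elim Z.m₁ Z.m₂ s) (Sum.elim Z.κ₁ Z.κ₂ s) t) ∘ Sum.inr
      = fun i ↦ quadTerm (Z.m₂ i) (Z.κ₂ i) t := rfl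
  have hs := HasSum.sum (f := fun s : Z.ι ⊕ Z.ι ↦ quadTerm (Sum.elim Z.m₁ Z.m₂ s) (Sum.elim Z.κ₁ Z.κ₂ s) t)
    (e₁ ▸ h₁.hasSum) (e₂ ▸ h₂.hasSum)
  have hψ : modelPsi Z.m₁ Z.m₂ Z.κ₁ Z.κ₂ t
      = ∑' i, quadTerm (Z.m₁ i) (Z.κ₁ i) t + ∑' i, quadTerm (Z.m₂ i) (Z.κ₂ i) t := by
    rw [modelPsi]; exact h₁.tsum_add h₂
  rw [hψ]; exact hs

/-! ## 20. Every lattice detects an attained supremum abscissa -/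

/-- **(α′) Every lattice detects an attained supremum abscissa in the model class** (rh-splitx-theory-1 g12,
signature verbatim).  Let `Z` be a configuration of off-line quadruples with positive multiplicities, exponents
`κ = σ + iγ` with `0 < σ < γ` (so `Re(m/κ²) < 0`) and `Re κ₂ = Re κ₁`, and summable `m/γ²` (`14 < γ`, the band and
the count clauses are NOT needed).  If the model screw function has a SUB-EXPONENTIAL FLOOR on one lattice `hℕ`
(`h > 0`): `∀ η > 0, ∃ K, ∀ k, -K e^{η k h} ≤ Ψ_Z(k h)`, then the supremum of the abscissae `Re κ₁ i` is NOT
attained.  (Positive dual of `not_criterion_of_classC`'s second conjunct: blind classes cannot derive attainedness,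
one lattice floor refutes it.)  Proof: `ScrewLatticeSup.strip_of_supAttained_of_latticeFloor` with ζ's zero series
replaced by the configuration series over `Z.ι ⊕ Z.ι`. -/
theorem Config.not_maxRe_of_latticeSubexpFloor (Z : Config) {h : ℝ} (hh : 0 < h)
    (hm : ∀ i, 0 < Z.m₁ i ∧ 0 < Z.m₂ i)
    (hre : ∀ i, 0 < (Z.κ₁ i).re ∧ (Z.κ₂ i).re = (Z.κ₁ i).re)
    (him : ∀ i, (Z.κ₁ i).re < (Z.κ₁ i).im ∧ (Z.κ₂ i).re < (Z.κ₂ i).im)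
    (hsum : Summable fun i ↦ Z.m₁ i / (Z.κ₁ i).im ^ 2 + Z.m₂ i / (Z.κ₂ i).im ^ 2)
    (hsef : ∀ η : ℝ, 0 < η → ∃ K : ℝ, ∀ k : ℕ, -K * Real.exp (η * (k * h)) ≤ Z.fold h k) :
    ¬ ∃ i, ∀ j, (Z.κ₁ j).re ≤ (Z.κ₁ i).re := by
  classical
  rintro ⟨i₀, hi₀⟩
  set B : ℝ := (Z.κ₁ i₀).re with hB
  have hBpos : 0 < B := (hre i₀).1
  obtain ⟨K, hK⟩ := hsef (B / 2) (by positivity)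
  -- the two pairs as ONE family over `Z.ι ⊕ Z.ι`
  set M : Z.ι ⊕ Z.ι → ℝ := Sum.elim Z.m₁ Z.m₂ with hM
  set Kp : Z.ι ⊕ Z.ι → ℂ := Sum.elim Z.κ₁ Z.κ₂ with hKp
  have hM0 : ∀ s, 0 < M s := by
    rintro (i | i)
    · simp only [hM, Sum.elim_inl]; exact (hm i).1
    · simp only [hM, Sum.elim_inr]; exact (hm i).2
  have hKre : ∀ s, 0 < (Kp s).re ∧ (Kp s).re ≤ B := by
    rintro (i | i)
    · simp only [hKp, Sum.elim_inl]; exact ⟨(hre i).1, hi₀ i⟩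
    · simp only [hKp, Sum.elim_inr]; rw [(hre i).2]; exact ⟨(hre i).1, hi₀ i⟩
  have hKim : ∀ s, (Kp s).re < (Kp s).im := by
    rintro (i | i)
    · simp only [hKp, Sum.elim_inl]; exact (him i).1
    · simp only [hKp, Sum.elim_inr]; exact (him i).2
  have hKim0 : ∀ s, (Kp s).im ≠ 0 := fun s ↦ by
    have := hKim s; have := (hKre s).1; exact ne_of_gt (by linarith)
  have hKabs : ∀ s, |(Kp s).re| < |(Kp s).im| := fun s ↦ by
    have h1 := hKim s; have h2 := (hKre s).1
    rw [abs_of_pos h2, abs_of_pos (by linarith)]; exact h1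
  set b : Z.ι ⊕ Z.ι → ℝ := fun s ↦ 16 * M s / (Kp s).im ^ 2 with hb
  set g : Z.ι ⊕ Z.ι → ℕ → ℝ := fun s k ↦ 2 * Real.exp (-(B * (k * h))) * quadTerm (M s) (Kp s) (k * h)
    with hg
  set c : Z.ι ⊕ Z.ι → ℂ := fun s ↦ if (Kp s).re = B then ((4 * M s : ℝ) : ℂ) / Kp s ^ 2 else 0 with hc
  set u : Z.ι ⊕ Z.ι → ℂ := fun s ↦ Complex.exp ((((Kp s).im * h : ℝ) : ℂ) * I) with hu
  have hs₁ : Summable fun i ↦ Z.m₁ i / (Z.κ₁ i).im ^ 2 := by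
    refine Summable.of_nonneg_of_le (fun i ↦ ?_) (fun i ↦ ?_) hsum
    · have := (hm i).1; positivity
    · have := (hm i).2; have : 0 ≤ Z.m₂ i / (Z.κ₂ i).im ^ 2 := by positivity
      linarith
  have hs₂ : Summable fun i ↦ Z.m₂ i / (Z.κ₂ i).im ^ 2 := by
    refine Summable.of_nonneg_of_le (fun i ↦ ?_) (fun i ↦ ?_) hsum
    · have := (hm i).2; positivity
    · have := (hm i).1; have : 0 ≤ Z.m₁ i / (Z.κ₁ i).im ^ 2 := by positivity
      linarith
  have hbs : Summable b := by
    refine Summable.sum _ ?_ ?_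
    · have e : b ∘ Sum.inl = fun i ↦ 16 * (Z.m₁ i / (Z.κ₁ i).im ^ 2) := by
        funext i; simp only [hb, hM, hKp, Function.comp, Sum.elim_inl]; ring
      rw [e]; exact hs₁.mul_left 16
    · have e : b ∘ Sum.inr = fun i ↦ 16 * (Z.m₂ i / (Z.κ₂ i).im ^ 2) := by
        funext i; simp only [hb, hM, hKp, Function.comp, Sum.elim_inr]; ring
      rw [e]; exact hs₂.mul_left 16
  have hgb : ∀ s k, |g s k| ≤ b s := fun s k ↦
    (abs_quadTerm_lattice_le (hM0 s).le (hKim0 s) (hKre s).1.le (hKre s).2 hh.le k).2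
  have hun : ∀ s, ‖u s‖ = 1 := fun s ↦ by
    simp only [hu]; exact Complex.norm_exp_ofReal_mul_I _
  have hcre : ∀ s, (c s).re ≤ 0 := fun s ↦ by
    simp only [hc]
    split_ifs
    · exact (re_coeff_neg_of_abs_re_lt (by have := hM0 s; positivity) (hKabs s)).le
    · simp
  have hcb : ∀ s, ‖c s‖ ≤ b s := fun s ↦ by
    have h0 : 0 ≤ M s := (hM0 s).le
    have hγ2 : 0 < (Kp s).im ^ 2 := by have := hKim0 s; positivity
    simp only [hc, hb]
    split_ifs
    · refine (norm_ofReal_div_sq_le _ (hKim0 s)).trans ?_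
      rw [abs_of_nonneg (by positivity : (0 : ℝ) ≤ 4 * M s), div_le_div_iff_of_pos_right hγ2]
      linarith
    · rw [norm_zero]; positivity
  have hlim : ∀ s, Tendsto (fun k : ℕ ↦ g s k - (c s * u s ^ k).re) atTop (𝓝 0) := by
    intro s
    by_cases htop : (Kp s).re = B
    · have hcs : c s = ((4 * M s : ℝ) : ℂ) / Kp s ^ 2 := by simp only [hc]; rw [if_pos htop]
      have := tendsto_quadTerm_lattice_top (hM0 s).le (hKim0 s) (hKre s).1 hh
      rw [htop] at this
      simpa only [hg, hcs, hu] using this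
    · have hcs : c s = 0 := by simp only [hc]; rw [if_neg htop]
      have hlt : (Kp s).re < B := lt_of_le_of_ne (hKre s).2 htop
      have := tendsto_quadTerm_lattice_low (hM0 s).le (hKim0 s) (hKre s).1.le hlt hh
      simpa only [hg, hcs, zero_mul, Complex.zero_re, sub_zero] using this
  -- the attained top atom has `Re c < 0`
  have h0 : (c (Sum.inl i₀)).re < 0 := by
    have htop : (Kp (Sum.inl i₀)).re = B := by simp only [hKp, Sum.elim_inl, hB]
    simp only [hc]
    rw [if_pos htop]
    exact re_coeff_neg_of_abs_re_lt (by have := hM0 (Sum.inl i₀); positivity) (hKabs _)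
  refine false_of_tsum_trig_eventually_ge hbs hgb hun hcre hcb hlim h0 ?_
  -- the floor: `Σ'_s g_s(k) = 2 e^{-Bkh} Ψ_Z(kh) ≥ -2K e^{-Bkh} e^{(B/2)kh} → 0`
  have hEt : Tendsto (fun k : ℕ ↦
      2 * K * (Real.exp (-(B * (k * h))) * Real.exp (B / 2 * (k * h)))) atTop (𝓝 0) := by
    simpa using (tendsto_exp_neg_mul_exp_lattice (by linarith : B / 2 < B) hh).const_mul (2 * K)
  intro ε hε
  obtain ⟨N₁, hN₁⟩ := eventually_atTop.1 (hEt.eventually (gt_mem_nhds hε))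
  refine ⟨N₁, fun k hk ↦ ?_⟩
  -- the two quad-term families are summable at `t = kh` (majorant `e^{Bkh}·8m/γ²`), and `Σ' g = 2e^{-Bkh}Ψ_Z(kh)`
  have h₁k : Summable fun i ↦ quadTerm (Z.m₁ i) (Z.κ₁ i) (k * h) := by
    refine Summable.of_norm_bounded
      (g := fun i ↦ Real.exp (B * (k * h)) * (8 * (Z.m₁ i / (Z.κ₁ i).im ^ 2))) ((hs₁.mul_left 8).mul_left _)
      (fun i ↦ ?_)
    rw [Real.norm_eq_abs]
    have hγ : (Z.κ₁ i).im ≠ 0 := ne_of_gt (lt_trans (hre i).1 (him i).1)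
    refine (abs_quadTerm_lattice_le (hm i).1.le hγ (hre i).1.le (hi₀ i) hh.le k).1.trans (le_of_eq ?_)
    ring
  have h₂k : Summable fun i ↦ quadTerm (Z.m₂ i) (Z.κ₂ i) (k * h) := by
    refine Summable.of_norm_bounded
      (g := fun i ↦ Real.exp (B * (k * h)) * (8 * (Z.m₂ i / (Z.κ₂ i).im ^ 2))) ((hs₂.mul_left 8).mul_left _)
      (fun i ↦ ?_)
    rw [Real.norm_eq_abs]
    have hσ : 0 < (Z.κ₂ i).re := by rw [(hre i).2]; exact (hre i).1
    have hσB : (Z.κ₂ i).re ≤ B := by rw [(hre i).2]; exact hi₀ i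
    have hγ : (Z.κ₂ i).im ≠ 0 := ne_of_gt (lt_trans hσ (him i).2)
    refine (abs_quadTerm_lattice_le (hm i).2.le hγ hσ.le hσB hh.le k).1.trans (le_of_eq ?_)
    ring
  have hgsum : HasSum (fun s ↦ g s k) (2 * Real.exp (-(B * (k * h))) * Z.fold h k) := by
    have := (Z.hasSum_sum_quadTerm (k * h) h₁k h₂k).mul_left (2 * Real.exp (-(B * (k * h))))
    simp only [hg, hM, hKp, Config.fold]
    exact this
  rw [hgsum.tsum_eq]
  have hy : 0 < Real.exp (-(B * (k * h))) := Real.exp_pos _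
  have h2 : 2 * Real.exp (-(B * (k * h))) * (-K * Real.exp (B / 2 * (k * h))) ≤
      2 * Real.exp (-(B * (k * h))) * Z.fold h k :=
    mul_le_mul_of_nonneg_left (hK k) (by positivity)
  have h3 : 2 * Real.exp (-(B * (k * h))) * (-K * Real.exp (B / 2 * (k * h))) =
      -(2 * K * (Real.exp (-(B * (k * h))) * Real.exp (B / 2 * (k * h)))) := by ring
  linarith [hN₁ k hk]

/-- Compatibility record (rh-splitx-theory-1 g12, 24.18 (α)): a configuration satisfying the thin blind clause list
is unattained — trivially from its clause `∀ i, ∃ j, Re κ₁ i < Re κ₁ j`; blind classes cannot DERIVE attainedness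
(`not_criterion_of_classC`), lattice floors REFUTE it (`Config.not_maxRe_of_latticeSubexpFloor`). -/
theorem not_maxRe_of_thinBlindClauses {h σs e : ℝ} (Z : Config) (hZ : ThinBlindClauses h σs e Z) :
    ¬ ∃ i, ∀ j, (Z.κ₁ j).re ≤ (Z.κ₁ i).re := by
  rintro ⟨i, hi⟩
  obtain ⟨j, hj⟩ := hZ.2.2.2.2.2.2.1 i
  exact absurd (hi j) (not_le.mpr hj)

end Summit.RiemannHypothesis.RiemannHypothesis.Theorems.Splittings.ScrewLatticeTower

end
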